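import Summits.HodgeConjecture.CorCM.Census.DecicWeil23TripleParts
import Summits.HodgeConjecture.CorCM.Census.DecicWeil23TripleDefect
import HarnessLib

/-!
# THREE `(2,3)`-types over one decic CM field: EXTRACTION of a generating part from a balanced configuration of
# `E × B₁ × B₂ × B₃` and the INDUCTION PRINCIPLE

COR-CM (cell `pub-hodgecm2`), seat b30 gen 22 (2026-08-22); count-neutral own lane DECIC-WEIL-23PAIR, part TRIPLE; sequel of
`Census/DecicWeil23Triple{,Defect,Parts}.lean` (model, DEFECT LAW, the part predicates `IsPairPartT`, `IsSixPartT`, `IsTenPartT`,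
their balance and selection from the counts).  Theorems only of a finite model; no definition, no named
fact, no geometry, no `sorry`.  The three-slot twin of `Census/DecicWeil23PairExtraction`.

RESULTS (kernel).  `exists_sixPartT_of_counts`, `exists_tenPartT_of_counts`; **EXTRACTION** `exists_part_of_modelBalancedT` — a
non-empty balanced configuration contains a pair part, a sixfold part or a tenfold part (by the defect law `d_{m,a} = t_m`,
`e = t_0 + t_1 + t_2`: two defects of strictly opposite signs ⇒ a tenfold part; else all non-zero `t_m` share the sign of `e` ⇒ a
sixfold part of such a slot; all `t_m = 0` ⇒ `e = 0` ⇒ conjugation-invariant counts ⇒ a pair part); **INDUCTION PRINCIPLE**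
`modelBalancedT_induction` — a property of configurations that holds for `∅` and is stable under adjoining a disjoint pair, sixfold
or tenfold part holds for every balanced configuration (any number of copies of `E, B₁, B₂, B₃`).
[cite: Pohlmann1968, Thm 1] [cite: GaoUllmo2025, Thm 3.1] [cite: Milne2020HodgeClassesAV, 1.2 (a) and Thm. 1]
[cite: MoonenZarhin1995Duke, Thm. 2.4]

## References
* [Pohlmann1968] Ann. of Math. 88 (1968), Thm 1.  [GaoUllmo2025] J. Inst. Math. Jussieu 25 (2025), Thm 3.1.
  [Milne2020HodgeClassesAV] arXiv:2010.08857, 1.2 (a), Thm. 1.  [MoonenZarhin1995Duke] Duke Math. J. 77 (1995), Thm. 2.4.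
-/

namespace Summit.HodgeConjecture.CorCM.Census.DecicWeil23Triple

open Finset

variable {α : Type*} {c : Fin 8} {v : α → PtT}

/-! ### Extraction and induction -/

/-- A sixfold part inside `T` from the counts: one point over `inl b` and one over each `(m, a, b)`. [folklore] -/
theorem exists_sixPartT_of_counts [DecidableEq α] {T : Finset α} (m : Fin 3) (b : Bool)
    (hE : 0 < (T.filter fun x => v x = Sum.inl b).card)
    (hB : ∀ a : Fin 5, 0 < (T.filter fun x => v x = Sum.inr (m, (a, b))).card) : ∃ G ⊆ T, IsSixPartT v m b G := by
  obtain ⟨x, hx⟩ := Finset.card_pos.1 hE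
  obtain ⟨hxT, hvx⟩ := Finset.mem_filter.1 hx
  obtain ⟨W, hWT, hW⟩ := exists_fivePartT_of_counts (v := v) (T := T) m b hB
  have hxW : x ∉ W := fun h => by
    obtain ⟨a, ha⟩ := hW.exists_eq_inr h
    rw [hvx] at ha; exact Sum.inl_ne_inr ha
  refine ⟨insert x W, Finset.insert_subset hxT hWT, ?_, ?_, fun a => ?_⟩
  · rw [Finset.card_insert_of_notMem hxW, hW.1]
  · rw [Finset.filter_insert, if_pos hvx, Finset.filter_false_of_mem fun z hz => ?_, Finset.card_insert_of_notMem (by simp)]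
    · rfl
    · obtain ⟨a, ha⟩ := hW.exists_eq_inr hz
      rw [ha]; exact Sum.inr_ne_inl
  · rw [Finset.filter_insert, if_neg (by rw [hvx]; exact Sum.inl_ne_inr), hW.2 a]

/-- A tenfold part inside `T` from the counts: one point over each `(m, a, true)` and each `(m', a, false)`. [folklore] -/
theorem exists_tenPartT_of_counts [DecidableEq α] {T : Finset α} (m m' : Fin 3)
    (h0 : ∀ a : Fin 5, 0 < (T.filter fun x => v x = Sum.inr (m, (a, true))).card)
    (h1 : ∀ a : Fin 5, 0 < (T.filter fun x => v x = Sum.inr (m', (a, false))).card) : ∃ G ⊆ T, IsTenPartT v m m' G := by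
  obtain ⟨W₀, hW₀T, hW₀⟩ := exists_fivePartT_of_counts (v := v) (T := T) m true h0
  obtain ⟨W₁, hW₁T, hW₁⟩ := exists_fivePartT_of_counts (v := v) (T := T) m' false h1
  have hW : Disjoint W₀ W₁ := by
    rw [Finset.disjoint_left]
    intro x hx0 hx1
    obtain ⟨a, ha⟩ := hW₀.exists_eq_inr hx0
    obtain ⟨a', ha'⟩ := hW₁.exists_eq_inr hx1
    have := ha.symm.trans ha'
    simp at this
  refine ⟨W₀ ∪ W₁, Finset.union_subset hW₀T hW₁T, ?_, fun a => ?_, fun a => ?_⟩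
  · rw [Finset.card_union_of_disjoint hW, hW₀.1, hW₁.1]
  · rw [Finset.filter_union, Finset.filter_false_of_mem (s := W₁) fun x hx => ?_, Finset.union_empty, hW₀.2 a]
    obtain ⟨a', ha'⟩ := hW₁.exists_eq_inr hx
    rw [ha']; simp
  · rw [Finset.filter_union, Finset.filter_false_of_mem (s := W₀) fun x hx => ?_, Finset.empty_union, hW₁.2 a]
    obtain ⟨a', ha'⟩ := hW₀.exists_eq_inr hx
    rw [ha']; simp

/-- **EXTRACTION.**  A non-empty balanced configuration contains a pair part, a sixfold part, or a tenfold part: by the defect law,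
two slots with defects of strictly opposite signs give a tenfold part; otherwise all non-zero defects share a sign, which is then the
sign of `e = t_0 + t_1 + t_2`, and a slot with non-zero defect gives a sixfold part; if all defects vanish, `e = 0` and the counts
are conjugation-invariant — a pair part. [cite: Milne2020HodgeClassesAV, 1.2 (a) and Thm. 1] [cite: MoonenZarhin1995Duke, Thm. 2.4] -/
theorem exists_part_of_modelBalancedT [DecidableEq α] {T : Finset α} (hT : ModelBalancedT c v T) (hne : T.Nonempty) :
    ∃ G ⊆ T, IsPairPartT v G ∨ (∃ m b, IsSixPartT v m b G) ∨ ∃ m m', IsTenPartT v m m' G := by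
  obtain ⟨t, ht, hE⟩ := exists_defectT_of_modelBalancedT hT
  -- the tenfold case: two defects of strictly opposite signs
  by_cases h10 : ∃ m m' : Fin 3, 0 < t m ∧ t m' < 0
  · obtain ⟨m, m', hm, hm'⟩ := h10
    obtain ⟨G, hG, h⟩ := exists_tenPartT_of_counts (v := v) (T := T) m m'
      (fun a => by have h := ht m a; omega) (fun a => by have h := ht m' a; omega)
    exact ⟨G, hG, Or.inr (Or.inr ⟨m, m', h⟩)⟩
  -- a sixfold part of positive sign
  by_cases hpos : ∃ m : Fin 3, 0 < t m
  · obtain ⟨m, hm⟩ := hpos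
    have hnn : ∀ m' : Fin 3, 0 ≤ t m' := fun m' => by
      by_contra h
      exact h10 ⟨m, m', hm, by omega⟩
    have h0 := hnn 0; have h1 := hnn 1; have h2 := hnn 2
    have hm3 : t m ≤ t 0 + t 1 + t 2 := by fin_cases m <;> simp <;> omega
    obtain ⟨G, hG, hS⟩ := exists_sixPartT_of_counts (v := v) (T := T) m true (by omega) fun a => by
      have h := ht m a; omega
    exact ⟨G, hG, Or.inr (Or.inl ⟨m, true, hS⟩)⟩
  -- a sixfold part of negative sign
  by_cases hneg : ∃ m : Fin 3, t m < 0
  · obtain ⟨m, hm⟩ := hneg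
    have hnp : ∀ m' : Fin 3, t m' ≤ 0 := fun m' => by
      by_contra h
      exact h10 ⟨m', m, by omega, hm⟩
    have h0 := hnp 0; have h1 := hnp 1; have h2 := hnp 2
    have hm3 : t 0 + t 1 + t 2 ≤ t m := by fin_cases m <;> simp <;> omega
    obtain ⟨G, hG, hS⟩ := exists_sixPartT_of_counts (v := v) (T := T) m false (by omega) fun a => by
      have h := ht m a; omega
    exact ⟨G, hG, Or.inr (Or.inl ⟨m, false, hS⟩)⟩
  -- all `t_m = 0`: conjugation-invariant counts, a pair part
  have hz : ∀ (m : Fin 3) (a : Fin 5), (T.filter fun x => v x = Sum.inr (m, (a, true))).card =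
      (T.filter fun x => v x = Sum.inr (m, (a, false))).card := by
    intro m a
    have htm : t m = 0 := by
      have h1 : ¬ 0 < t m := fun h => hpos ⟨m, h⟩
      have h2 : ¬ t m < 0 := fun h => hneg ⟨m, h⟩
      omega
    have h := ht m a
    omega
  have ht0 : t 0 = 0 := by
    have h1 : ¬ 0 < t 0 := fun h => hpos ⟨0, h⟩
    have h2 : ¬ t 0 < 0 := fun h => hneg ⟨0, h⟩
    omega
  have ht1 : t 1 = 0 := by
    have h1 : ¬ 0 < t 1 := fun h => hpos ⟨1, h⟩
    have h2 : ¬ t 1 < 0 := fun h => hneg ⟨1, h⟩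
    omega
  have ht2 : t 2 = 0 := by
    have h1 : ¬ 0 < t 2 := fun h => hpos ⟨2, h⟩
    have h2 : ¬ t 2 < 0 := fun h => hneg ⟨2, h⟩
    omega
  have hEE : (T.filter fun x => v x = Sum.inl true).card = (T.filter fun x => v x = Sum.inl false).card := by omega
  obtain ⟨x, hx⟩ := hne
  have hNx : 0 < (T.filter fun x' => v x' = v x).card := Finset.card_pos.2 ⟨x, Finset.mem_filter.2 ⟨hx, rfl⟩⟩
  have hNcx : 0 < (T.filter fun x' => v x' = cjT (v x)).card := by
    rcases hvx : v x with s | ⟨m, ⟨a, s⟩⟩ <;> rw [hvx] at hNx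
    · cases s
      · rw [cjT_inl, Bool.not_false]; omega
      · rw [cjT_inl, Bool.not_true]; omega
    · have h := hz m a
      cases s
      · rw [cjT_inr, Bool.not_false]; omega
      · rw [cjT_inr, Bool.not_true]; omega
  obtain ⟨G, hG, hP⟩ := exists_pairPartT_of_counts (y := v x) hNx hNcx
  exact ⟨G, hG, Or.inl hP⟩

/-- **INDUCTION PRINCIPLE FOR BALANCED CONFIGURATIONS (any number of copies of `E, B₁, B₂, B₃`).**  If `motive` holds for `∅` and
passes from `R` to `G ∪ R` for `G` disjoint from `R` a pair part, a sixfold part, or a tenfold part, then `motive` holds for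
every balanced configuration. [cite: Milne2020HodgeClassesAV, 1.2 (a) and Thm. 1] [cite: GaoUllmo2025, Thm 3.1] -/
theorem modelBalancedT_induction [DecidableEq α] {motive : Finset α → Prop} (h0 : motive ∅)
    (hpair : ∀ G R : Finset α, Disjoint G R → IsPairPartT v G → motive R → motive (G ∪ R))
    (hsix : ∀ (G R : Finset α) (m : Fin 3) (b : Bool), Disjoint G R → IsSixPartT v m b G → motive R → motive (G ∪ R))
    (hten : ∀ (G R : Finset α) (m m' : Fin 3), Disjoint G R → IsTenPartT v m m' G → motive R → motive (G ∪ R))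
    {T : Finset α} (hT : ModelBalancedT c v T) : motive T := by
  induction T using Finset.strongInduction with
  | H T ih =>
    by_cases hTe : T = ∅
    · subst hTe; exact h0
    obtain ⟨G, hGT, hG⟩ := exists_part_of_modelBalancedT hT (Finset.nonempty_iff_ne_empty.2 hTe)
    rcases hG with hP | ⟨m, b, hS⟩ | ⟨m, m', h10⟩
    · have hR : ModelBalancedT c v (T \ G) := hT.sdiff hP.modelBalancedT hGT
      have hlt : T \ G ⊂ T := Finset.sdiff_ssubset hGT hP.nonempty
      have h := hpair G (T \ G) Finset.disjoint_sdiff hP (ih _ hlt hR)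
      rwa [Finset.union_sdiff_of_subset hGT] at h
    · have hR : ModelBalancedT c v (T \ G) := hT.sdiff hS.modelBalancedT hGT
      have hlt : T \ G ⊂ T := Finset.sdiff_ssubset hGT hS.nonempty
      have h := hsix G (T \ G) m b Finset.disjoint_sdiff hS (ih _ hlt hR)
      rwa [Finset.union_sdiff_of_subset hGT] at h
    · have hR : ModelBalancedT c v (T \ G) := hT.sdiff h10.modelBalancedT hGT
      have hlt : T \ G ⊂ T := Finset.sdiff_ssubset hGT h10.nonempty
      have h := hten G (T \ G) m m' Finset.disjoint_sdiff h10 (ih _ hlt hR)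
      rwa [Finset.union_sdiff_of_subset hGT] at h

end Summit.HodgeConjecture.CorCM.Census.DecicWeil23Triple
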